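import Summits.AtomisticToContinuum.BoseEinsteinCondensation.Theses.BECStronglyRayleigh
import Literature.MathematicalPhysics.QuantumLattice.LiebMattisLadder
import HarnessLib

/-!
# Negative lemmas for crux `InsertionFieldDelocalisation` (stmt-AtomisticToContinuum-9673), I: the crux
unfolded and a toolkit

Supports (does not close) stmt-AtomisticToContinuum-9673, route `BECStronglyRayleigh` (crux #3, card item
K1: one constant `M` with `L³ Σ_T ‖r^T‖²Φ_T ≤ M Σ_T ‖r^T‖²` for every nonnegative sector-`N` ground vector
of `xyTorus 3 L 1`, `2 ≤ N ≤ L³/2`).  Nothing in this family asserts a Theses statement positively.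

* `insertionFieldDelocalisation_iff` : the crux is `∃ M, InsertionFieldDelocalisationAt M`, its body
  factored as `K1Ineq M L N ψ` through the insertion field `field ψ T` and the functionals
  `K1lhs r = Σr³/Σr + (Σr²)²/(Σr)²`, `K1rhs r = Σr²` (definitional, `Iff.rfl`).
* toolkit: occupation indicators `1_S`, basis vectors `δ_σ` (`bvec`) and their sectors
  (`bvec_ind_mem_spinZSector`), the functionals on `{0,1}`-valued fields, large tori.

Companion files: `PerronExistence.lean` (nonnegative sector ground vectors of the XY model exist; no
dependence on this file), `LoadBearing.lean` (the eigen-equation and `2N ≤ L³` are load-bearing) and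
`Tightness.lean` (Cauchy–Schwarz floor; any admissible constant is `≥ 4`; trivial ceiling `2L³`).
-/

noncomputable section

namespace Summit.AtomisticToContinuum.BoseEinsteinCondensation.Theorems.InsertionFieldDelocalisation.Negative

open scoped BigOperators ComplexOrder
open Literature.MathematicalPhysics.QuantumLattice Literature.Probability.LatticeModels Matrix Finset
open Summit.AtomisticToContinuum.BoseEinsteinCondensation.Theses.BECStronglyRayleigh

/-! ### The crux, its body at a fixed constant, and the functional it bounds -/

/-- The two-particle insertion field `r^T_x = Σ_y [x ∉ T, y ∉ T, x ≠ y] Re ψ(1_{T ∪ {x,y}})` of a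
vector `ψ ∈ ℓ²({0,1}^Λ)` (occupied = index `0`), exactly as in the crux. -/
def field {Λ : Type*} [Fintype Λ] [DecidableEq Λ] (ψ : TensorIndex Λ 2 → ℂ) (T : Finset Λ)
    (x : Λ) : ℝ :=
  ∑ y, if x ∉ T ∧ y ∉ T ∧ x ≠ y then
    (ψ (fun z => if z ∈ insert x (insert y T) then 0 else 1)).re else 0

/-- `‖r‖² Φ(r) = Σ_x r³ / Σ_x r + (Σ_x r²)² / (Σ_x r)²`, the left-hand functional of the crux. -/
def K1lhs {ι : Type*} [Fintype ι] (r : ι → ℝ) : ℝ :=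
  (∑ x, r x ^ 3) / (∑ x, r x) + (∑ x, r x ^ 2) ^ 2 / (∑ x, r x) ^ 2

/-- `‖r‖² = Σ_x r²`, the right-hand functional (the `ω`-weight) of the crux. -/
def K1rhs {ι : Type*} [Fintype ι] (r : ι → ℝ) : ℝ :=
  ∑ x, r x ^ 2

/-- The K1 inequality at constant `M` for the data `(L, N, ψ)`: the `let`-body of the crux,
`L³ · Σ_T ‖r^T‖²Φ_T ≤ M · Σ_T ‖r^T‖²`. -/
def K1Ineq (M : ℝ) (L : ℕ) [NeZero L] (N : ℕ) (ψ : TensorIndex (TorusSite 3 L) 2 → ℂ) : Prop :=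
  (L : ℝ) ^ 3 * ∑ T ∈ (Finset.univ : Finset (TorusSite 3 L)).powersetCard (N - 2), K1lhs (field ψ T) ≤
    M * ∑ T ∈ (Finset.univ : Finset (TorusSite 3 L)).powersetCard (N - 2), K1rhs (field ψ T)

/-- The crux with the constant exposed. -/
def InsertionFieldDelocalisationAt (M : ℝ) : Prop :=
  ∀ (L : ℕ) [NeZero L], 2 ≤ L → ∀ N : ℕ, 2 ≤ N → 2 * N ≤ L ^ 3 →
    ∀ ψ : TensorIndex (TorusSite 3 L) 2 → ℂ,
      ψ ∈ spinZSector 1 ((N : ℝ) - (L : ℝ) ^ 3 / 2) → ψ ≠ 0 →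
      (xyTorus 3 L 1).mulVec ψ =
        ((lowestEnergyInSector 1 (xyTorus 3 L 1) ((N : ℝ) - (L : ℝ) ^ 3 / 2) : ℝ) : ℂ) • ψ →
      (∀ σ, 0 ≤ (ψ σ).re ∧ (ψ σ).im = 0) → K1Ineq M L N ψ

/-- **The crux, unfolded**: `InsertionFieldDelocalisation ↔ ∃ M, InsertionFieldDelocalisationAt M`
(definitional). -/
theorem insertionFieldDelocalisation_iff :
    InsertionFieldDelocalisation ↔ ∃ M : ℝ, InsertionFieldDelocalisationAt M := Iff.rfl

/-! ### Toolkit: occupation indicators, basis vectors, sizes -/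

section Toolkit

variable {Λ : Type*} [Fintype Λ] [DecidableEq Λ]

omit [Fintype Λ] in
/-- `1_S = 1_{S'}` iff `S = S'` (occupation indicators, occupied = index `0`). [folklore] -/
theorem ind_eq_ind_iff (S S' : Finset Λ) :
    ((fun z => if z ∈ S then (0 : Fin 2) else 1) = fun z => if z ∈ S' then (0 : Fin 2) else 1) ↔
      S = S' := by
  constructor
  · intro h
    ext z
    have hz := congrFun h z
    by_cases h1 : z ∈ S <;> by_cases h2 : z ∈ S' <;> simp_all
  · rintro rfl
    rfl

/-- The basis vector `δ_{σ₀}` of `ℓ²({0,1}^Λ)`. [folklore] -/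
def bvec (σ₀ : TensorIndex Λ 2) : TensorIndex Λ 2 → ℂ := fun σ => if σ = σ₀ then 1 else 0

omit [DecidableEq Λ] in
/-- Entries of `δ_{σ₀}`. [folklore] -/
theorem bvec_apply (σ₀ σ : TensorIndex Λ 2) : bvec σ₀ σ = if σ = σ₀ then 1 else 0 := rfl

omit [DecidableEq Λ] in
/-- `δ_{σ₀}` is entrywise real and nonnegative. [folklore] -/
theorem bvec_nonneg (σ₀ : TensorIndex Λ 2) : ∀ σ, 0 ≤ (bvec σ₀ σ).re ∧ (bvec σ₀ σ).im = 0 := by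
  intro σ
  rw [bvec_apply]
  split_ifs <;> simp

omit [DecidableEq Λ] in
/-- `δ_{σ₀} ≠ 0`. [folklore] -/
theorem bvec_ne_zero (σ₀ : TensorIndex Λ 2) : bvec σ₀ ≠ 0 := fun h => by
  simpa [bvec_apply] using congrFun h σ₀

/-- Occupation amplitudes of `δ_{1_{S₀}}`: `Re δ_{1_{S₀}}(1_S) = [S = S₀]`. [folklore] -/
theorem bvec_ind_re (S₀ S : Finset Λ) :
    (bvec (fun z => if z ∈ S₀ then (0 : Fin 2) else 1) (fun z => if z ∈ S then (0 : Fin 2) else 1)).re =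
      if S = S₀ then 1 else 0 := by
  rw [bvec_apply]
  by_cases h : S = S₀
  · subst h
    simp
  · rw [if_neg (mt (ind_eq_ind_iff S S₀).mp h), if_neg h, Complex.zero_re]

/-- `δ_{1_{S₀}}` lies in the magnetisation sector `M = |S₀| - |Λ|/2` (spin `½`, `|S₀|` up-spins).
[folklore] -/
theorem bvec_ind_mem_spinZSector (S₀ : Finset Λ) (M : ℝ)
    (hM : M = (S₀.card : ℝ) - (Fintype.card Λ : ℝ) / 2) :
    bvec (fun z => if z ∈ S₀ then (0 : Fin 2) else 1) ∈ spinZSector 1 M := by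
  rw [LiebMattis.mem_spinZSector_iff]
  intro σ hσ
  rw [bvec_apply] at hσ
  have hσ' : σ = fun z => if z ∈ S₀ then (0 : Fin 2) else 1 := by
    by_contra h
    exact hσ (if_neg h)
  subst hσ'
  have hsummand : ∀ x : Λ, ((1 : ℕ) : ℂ) / 2 - (((if x ∈ S₀ then (0 : Fin 2) else 1 : Fin 2) : ℕ) : ℂ) =
      if x ∈ S₀ then (1 / 2 : ℂ) else (-(1 / 2) : ℂ) := by
    intro x
    by_cases hx : x ∈ S₀
    · simp [hx]
    · simp [hx]; ring
  rw [Finset.sum_congr rfl fun x _ => hsummand x, Finset.sum_ite, Finset.sum_const, Finset.sum_const,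
    Finset.filter_mem_eq_inter, Finset.univ_inter, hM]
  have hc : (Finset.univ.filter fun x => x ∉ S₀) = S₀ᶜ := by
    ext x; simp [Finset.mem_compl]
  rw [hc, Finset.card_compl, nsmul_eq_mul, nsmul_eq_mul, Nat.cast_sub (Finset.card_le_univ S₀)]
  push_cast
  ring

/-- `A δ_{σ₀} = (σ ↦ A σ σ₀)` (a column of `A`). [folklore] -/
theorem mulVec_bvec (A : Matrix (TensorIndex Λ 2) (TensorIndex Λ 2) ℂ) (σ₀ : TensorIndex Λ 2) :
    A *ᵥ bvec σ₀ = fun σ => A σ σ₀ := by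
  funext σ
  simp only [mulVec, dotProduct, bvec_apply, mul_ite, mul_one, mul_zero, Finset.sum_ite_eq',
    Finset.mem_univ, if_true]

omit [DecidableEq Λ] in
/-- Power sums of a `{0,1}`-valued vector: `Σ_x [p x]^k = #{p}` (`k ≥ 1`). [folklore] -/
theorem sum_boolIndicator_pow (p : Λ → Prop) [DecidablePred p] (k : ℕ) (hk : k ≠ 0) :
    (∑ x : Λ, (if p x then (1 : ℝ) else 0) ^ k) = ((Finset.univ.filter p).card : ℝ) := by
  have h : ∀ x : Λ, (if p x then (1 : ℝ) else 0) ^ k = if p x then 1 else 0 := by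
    intro x
    split_ifs
    · exact one_pow k
    · exact zero_pow hk
  simp_rw [h, Finset.sum_boole]

omit [DecidableEq Λ] in
/-- On a `{0,1}`-valued vector with `m > 0` ones, `‖r‖²Φ(r) = m/m + m²/m² = 2`. [folklore] -/
theorem K1lhs_boolIndicator (p : Λ → Prop) [DecidablePred p] (hp : 0 < (Finset.univ.filter p).card) :
    K1lhs (fun x => if p x then (1 : ℝ) else 0) = 2 := by
  rw [K1lhs, sum_boolIndicator_pow p 3 (by norm_num), sum_boolIndicator_pow p 2 (by norm_num)]
  have h1 : (∑ x : Λ, (if p x then (1 : ℝ) else 0)) = ((Finset.univ.filter p).card : ℝ) := by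
    have h := sum_boolIndicator_pow p 1 one_ne_zero
    simp only [pow_one] at h
    exact h
  rw [h1]
  have hm : (0 : ℝ) < ((Finset.univ.filter p).card : ℝ) := by exact_mod_cast hp
  field_simp
  ring

omit [DecidableEq Λ] in
/-- On a `{0,1}`-valued vector with `m` ones, `‖r‖² = m`. [folklore] -/
theorem K1rhs_boolIndicator (p : Λ → Prop) [DecidablePred p] :
    K1rhs (fun x => if p x then (1 : ℝ) else 0) = ((Finset.univ.filter p).card : ℝ) := by
  rw [K1rhs, sum_boolIndicator_pow p 2 (by norm_num)]

/-- A large torus: for every real `M` there is `L ≥ 2` with `M < L³`. [folklore] -/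
theorem exists_side_gt (M : ℝ) : ∃ L : ℕ, 2 ≤ L ∧ M < (L : ℝ) ^ 3 := by
  obtain ⟨n, hn⟩ := exists_nat_gt M
  refine ⟨n + 2, by omega, hn.trans_le ?_⟩
  have h1 : (n : ℝ) ≤ ((n + 2 : ℕ) : ℝ) := by exact_mod_cast Nat.le_add_right n 2
  have h2 : (1 : ℝ) ≤ ((n + 2 : ℕ) : ℝ) := by exact_mod_cast (by omega : 1 ≤ n + 2)
  calc (n : ℝ) ≤ ((n + 2 : ℕ) : ℝ) := h1
    _ ≤ ((n + 2 : ℕ) : ℝ) ^ 3 := le_self_pow₀ h2 (by norm_num)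

end Toolkit


end Summit.AtomisticToContinuum.BoseEinsteinCondensation.Theorems.InsertionFieldDelocalisation.Negative
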